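import Summits.BirchSwinnertonDyer.BirchSwinnertonDyer.Theorems.Rank1ResidualJetSection6
import HarnessLib

/-!
# T1 JET (cell `bsd-jet`), road K: the abstract Thm 6.3 in McCALLUM'S ORDER CURRENCY — the class
# `κ_{c,m}` enters only through `addOrderOf κ_{c,m} = p^{m − m_∞}` (no auxiliary `κ̃`)

HONEST FRAMING (programme file §HONESTY, verbatim): «no tranche here proves BSD; ARM L moves the
LITERAL column of an r ≤ 1 census into the kernel-proved-modulo-named-print column.» THEOREMS ONLY
(seat `bsd-jet-pv-2`, session g2; `--supports stmt-BirchSwinnertonDyer-14418`, helper); 0 classes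
move. WHY: `Section6.tamagawaExponent_le_mInfty_of_minimalCoreVertex` (p471669) follows print and takes
the auxiliary class `κ̃_{c,m}` of order `p^m` with `κ_{c,m} = p^{m(c)} κ̃_{c,m}` ([J] §3.1 item 7),
applying Lemma 6.1 to `κ̃`; the printed proof only USES `ord loc_λ κ_{c,m} = p^{m − m_∞}`. The typed
McCallum facts speak of the class `c_M(n)` and its order `p^{M − ord_p P_n}` directly
(`McCallum1991.prop52_…`: *"`c_M(n)` has order `p^{M−M_r}` iff `p^{M_r} ∥ P_n`"*), and the tree's
`h61`-adapter (`JET.exists_kolyvaginPrime_addOrderOf_localization_eq_of_cor32`,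
`Rank1ResidualJetCebotarevAdapter.lean`) preserves the order of ANY class. So this file re-proves the
abstract theorem with `(κ, hordκ : addOrderOf κ = p ^ (m − m_∞))` in place of `(κ̃, κ, hκ, hκ̃)`,
applying `h61` to `κ` itself — one named input (S7's «`p^{m(c)}`-th root class») fewer for the
instantiation `H63`. Proof otherwise verbatim.
References: [cite: Jetchev2008, Thm. 5.2 and its proof (pp. 821–822) = arXiv Thm. 6.3; §3.1 item 7]
[cite: McCallumLMS1991, §5 Prop. 5.2 (p. 304), §4 Cor. 4.5].
-/

set_option autoImplicit false

noncomputable section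

open scoped Classical

namespace Summit.BirchSwinnertonDyer.Rank1Residual.JET.Section6

/-- **[J] Thm 6.3 (= print Thm 5.2), abstract kernel form, ORDER CURRENCY**: as
`tamagawaExponent_le_mInfty_of_minimalCoreVertex` but the class `κ_{c,m} ∈ H¹(K,E[p^m])^{ε(c)}` enters
only through its order `p^{m − m_∞}` (`m(c) = m_∞ ≤ m`), and Lemma 6.1 is applied to `κ_{c,m}` itself
together with a generator of `𝓗_{𝓕₀(c)^*}^{−ε}`. CONCLUSION `t ≤ m_∞`. Same printed proof (pp. 823–824
of the arXiv text, −ε side). [cite: Jetchev2008, Thm. 5.2 (p. 821) and its proof; Lemma 5.1; Prop. 4.4; Lemma 3.4 (iii)]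
[cite: McCallumLMS1991, §4 Cor. 4.5, §5 Prop. 5.2] -/
theorem tamagawaExponent_le_mInfty_of_minimalCoreVertex_orderForm
    {p : ℕ} (hp : p.Prime) {m t mInf : ℕ} (htm : t ≤ m) (hInfm : mInf ≤ m)
    -- global cohomology `H¹(K, E[p^m])^{ε(c)}`, `H¹(K, E[p^m])^{−ε(c)}`; Kolyvagin primes `ℓ ∈ Λ¹_m`, `ℓ ∤ c`
    {Hp Hm : Type*} [AddCommGroup Hp] [AddCommGroup Hm] {ι : Type*}
    -- local cohomology at `λ ∣ ℓ`, `±` parts, with `loc_λ`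
    {Lp Lm : ι → Type*} [∀ ℓ, AddCommGroup (Lp ℓ)] [∀ ℓ, AddCommGroup (Lm ℓ)]
    (locP : ∀ ℓ, Hp →+ Lp ℓ) (locM : ∀ ℓ, Hm →+ Lm ℓ)
    -- the `−ε(c)` Selmer modules
    (A' B' C' : AddSubgroup Hm) (D' : ι → AddSubgroup Hm)
    (hB'A' : B' ≤ A') (hcore : A' = ⊥)
    -- Thm. 5.1 at the carrier `q` for `𝓕₀(c) ≼ 𝓕(c)`, `−ε` parts, and (δ)
    {Q Q' : Type*} [AddCommGroup Q] [AddCommGroup Q'] [Finite Q']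
    (locq : A' →+ Q) (locq' : C' →+ Q')
    (hker : ∀ x : C', locq' x = 0 ↔ (x : Hm) ∈ A')
    (horth_q : Nat.card locq.range * Nat.card locq'.range = Nat.card Q')
    (hQ'cyc : IsAddCyclic Q') (hQ'card : Nat.card Q' = p ^ t)
    -- Lemma 6.1 (Čebotarev)
    (h61 : ∀ (x : Hp) (y : Hm), y ≠ 0 →
      ∃ ℓ, addOrderOf (locP ℓ x) = addOrderOf x ∧ addOrderOf (locM ℓ y) = addOrderOf y)
    -- Thm. 5.1 / Lemma 5.2 (iii) at `λ` for `𝓕₀(c) ≼ (𝓕₀)^ℓ(c)`, `−ε` parts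
    {S : ι → Type*} [∀ ℓ, AddCommGroup (S ℓ)] (sing : ∀ ℓ, D' ℓ →+ S ℓ)
    (hsing : ∀ ℓ (x : D' ℓ), sing ℓ x = 0 ↔ (x : Hm) ∈ B')
    (horth_ℓ : ∀ ℓ, Nat.card (sing ℓ).range * Nat.card (C'.map (locM ℓ)) = p ^ m)
    -- the classes: `κ_{c,m}` of order `p^{m − m(c)}`, `m(c) = m_∞` (McCallum's currency), `κ_{cℓ,m}`
    (κ : Hp) (hordκ : addOrderOf κ = p ^ (m - mInf))
    (κℓ : ι → Hm) (h49 : ∀ ℓ, κℓ ℓ ∈ D' ℓ)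
    (h47 : ∀ ℓ, addOrderOf (locM ℓ (κℓ ℓ)) = addOrderOf (locP ℓ κ)) :
    t ≤ mInf := by
  -- trivial when `t = 0`
  rcases Nat.eq_zero_or_pos t with ht0 | ht0
  · omega
  -- `B' = 0`
  have hB' : B' = ⊥ := le_bot_iff.mp (hcore ▸ hB'A')
  -- `locq` has trivial image (its source `A'` is trivial), so `#im locq' = #Q' = p^t`
  have hrange_q : Nat.card locq.range = 1 := by
    have : locq.range = ⊥ := by
      rw [eq_bot_iff]
      rintro _ ⟨x, rfl⟩
      have hx : (x : Hm) ∈ (⊥ : AddSubgroup Hm) := hcore ▸ x.2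
      have : x = 0 := by ext; simpa using hx
      simp [this]
    rw [this, AddSubgroup.card_bot]
  rw [hrange_q, one_mul, hQ'card] at horth_q
  -- `locq'` is injective (its kernel is `A' = 0`)
  have hinj : Function.Injective locq' := by
    rw [injective_iff_map_eq_zero]
    intro x hx
    have hx' : (x : Hm) ∈ (⊥ : AddSubgroup Hm) := hcore ▸ (hker x).mp hx
    ext; simpa using hx'
  -- hence `C'` is cyclic of order `p^t`
  haveI : IsAddCyclic C' := isAddCyclic_of_injective locq' hinj
  have hcardC' : Nat.card C' = p ^ t := by
    rw [← horth_q]; exact Nat.card_congr (AddMonoidHom.ofInjective hinj).toEquiv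
  obtain ⟨g, hg⟩ := IsAddCyclic.exists_generator (α := C')
  have hordg : addOrderOf (g : Hm) = p ^ t := by
    rw [AddSubgroup.addOrderOf_coe, addOrderOf_eq_card_of_forall_mem_zmultiples hg, hcardC']
  have hg0 : (g : Hm) ≠ 0 := by
    intro h
    rw [h, addOrderOf_zero] at hordg
    have : 1 < p ^ t := Nat.one_lt_pow ht0.ne' hp.one_lt
    omega
  -- `C'` is generated by `g` inside `Hm`
  have hC'eq : C' = AddSubgroup.zmultiples (g : Hm) := by
    apply le_antisymm
    · intro x hx
      obtain ⟨k, hk⟩ := AddSubgroup.mem_zmultiples_iff.mp (hg ⟨x, hx⟩)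
      exact AddSubgroup.mem_zmultiples_iff.mpr ⟨k, by simpa using congrArg Subtype.val hk⟩
    · exact AddSubgroup.zmultiples_le_of_mem g.2
  -- Lemma 6.1: choose `ℓ` (applied to `κ` itself and the generator of `C'`)
  obtain ⟨ℓ, hℓP, hℓM⟩ := h61 κ (g : Hm) hg0
  rw [hordκ] at hℓP
  rw [hordg] at hℓM
  -- `#loc_λ(C') = p^t`, so `#D' ℓ = p^(m - t)`
  have hcard_img : Nat.card (C'.map (locM ℓ)) = p ^ t := by
    rw [hC'eq, AddMonoidHom.map_zmultiples, Nat.card_zmultiples, hℓM]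
  have hsing_inj : Function.Injective (sing ℓ) := by
    rw [injective_iff_map_eq_zero]
    intro x hx
    have hx' : (x : Hm) ∈ (⊥ : AddSubgroup Hm) := hB' ▸ (hsing ℓ x).mp hx
    ext; simpa using hx'
  have hcardD : Nat.card (D' ℓ) = p ^ (m - t) := by
    have h1 : Nat.card (D' ℓ) = Nat.card (sing ℓ).range :=
      Nat.card_congr (AddMonoidHom.ofInjective hsing_inj).toEquiv
    have h2 := horth_ℓ ℓ
    rw [hcard_img, ← h1, ← Nat.sub_add_cancel htm, pow_add] at h2
    exact Nat.eq_of_mul_eq_mul_right (pow_pos hp.pos t) h2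
  -- the order of `loc_λ κ_{cℓ,m}` divides `p^(m - t)` …
  have hdvd : addOrderOf (locM ℓ (κℓ ℓ)) ∣ p ^ (m - t) :=
    hcardD ▸ addOrderOf_map_dvd_card_of_mem (locM ℓ) (D' ℓ) (h49 ℓ)
  -- … and equals `ord loc_λ κ_{c,m} = ord κ_{c,m} = p^(m - mInf)`
  rw [h47 ℓ, hℓP, Nat.pow_dvd_pow_iff_le_right hp.one_lt] at hdvd
  omega


/-- **[J] Thm 6.3 (= print Thm 5.2), abstract, ROW FORM**: as `…_orderForm`, with Lemma 6.1 (`h61`)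
required ONLY for the class `κ_{c,m}` and the non-zero classes of `𝓗_{𝓕₀(c)^*}^{−ε}` — the single
instance the printed proof uses — so that `H^{±ε}` may be taken to be ALL of `H¹(K, E[p^m])` in the
instantiation (the eigen-conditions travel with `κ` and with `C' ≤ H¹(K,E[p^m])^{−ε}`, as the tree's
Čebotarev adapter `JET.exists_kolyvaginPrime_addOrderOf_localization_eq_of_cor32` wants). Same proof.
[cite: Jetchev2008, Thm. 5.2 (p. 821) and its proof; Lemma 5.1] [cite: McCallumLMS1991, §3 Cor. 3.2] -/
theorem tamagawaExponent_le_mInfty_of_minimalCoreVertex_rowForm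
    {p : ℕ} (hp : p.Prime) {m t mInf : ℕ} (htm : t ≤ m) (hInfm : mInf ≤ m)
    -- global cohomology `H¹(K, E[p^m])^{ε(c)}`, `H¹(K, E[p^m])^{−ε(c)}`; Kolyvagin primes `ℓ ∈ Λ¹_m`, `ℓ ∤ c`
    {Hp Hm : Type*} [AddCommGroup Hp] [AddCommGroup Hm] {ι : Type*}
    -- local cohomology at `λ ∣ ℓ`, `±` parts, with `loc_λ`
    {Lp Lm : ι → Type*} [∀ ℓ, AddCommGroup (Lp ℓ)] [∀ ℓ, AddCommGroup (Lm ℓ)]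
    (locP : ∀ ℓ, Hp →+ Lp ℓ) (locM : ∀ ℓ, Hm →+ Lm ℓ)
    -- the `−ε(c)` Selmer modules
    (A' B' C' : AddSubgroup Hm) (D' : ι → AddSubgroup Hm)
    (hB'A' : B' ≤ A') (hcore : A' = ⊥)
    -- Thm. 5.1 at the carrier `q` for `𝓕₀(c) ≼ 𝓕(c)`, `−ε` parts, and (δ)
    {Q Q' : Type*} [AddCommGroup Q] [AddCommGroup Q'] [Finite Q']
    (locq : A' →+ Q) (locq' : C' →+ Q')
    (hker : ∀ x : C', locq' x = 0 ↔ (x : Hm) ∈ A')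
    (horth_q : Nat.card locq.range * Nat.card locq'.range = Nat.card Q')
    (hQ'cyc : IsAddCyclic Q') (hQ'card : Nat.card Q' = p ^ t)
    -- Lemma 6.1 (Čebotarev)
    -- the class `κ_{c,m}` of order `p^{m − m(c)}`, `m(c) = m_∞` (McCallum's currency)
    (κ : Hp) (hordκ : addOrderOf κ = p ^ (m - mInf))
    -- Lemma 6.1 (Čebotarev) for `κ` and the non-zero classes of `𝓗_{𝓕₀(c)^*}^{−ε}` only
    (h61 : ∀ y : Hm, y ∈ C' → y ≠ 0 →
      ∃ ℓ, addOrderOf (locP ℓ κ) = addOrderOf κ ∧ addOrderOf (locM ℓ y) = addOrderOf y)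
    -- Thm. 5.1 / Lemma 5.2 (iii) at `λ` for `𝓕₀(c) ≼ (𝓕₀)^ℓ(c)`, `−ε` parts
    {S : ι → Type*} [∀ ℓ, AddCommGroup (S ℓ)] (sing : ∀ ℓ, D' ℓ →+ S ℓ)
    (hsing : ∀ ℓ (x : D' ℓ), sing ℓ x = 0 ↔ (x : Hm) ∈ B')
    (horth_ℓ : ∀ ℓ, Nat.card (sing ℓ).range * Nat.card (C'.map (locM ℓ)) = p ^ m)
    -- the classes `κ_{cℓ,m}`
    (κℓ : ι → Hm) (h49 : ∀ ℓ, κℓ ℓ ∈ D' ℓ)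
    (h47 : ∀ ℓ, addOrderOf (locM ℓ (κℓ ℓ)) = addOrderOf (locP ℓ κ)) :
    t ≤ mInf := by
  -- trivial when `t = 0`
  rcases Nat.eq_zero_or_pos t with ht0 | ht0
  · omega
  -- `B' = 0`
  have hB' : B' = ⊥ := le_bot_iff.mp (hcore ▸ hB'A')
  -- `locq` has trivial image (its source `A'` is trivial), so `#im locq' = #Q' = p^t`
  have hrange_q : Nat.card locq.range = 1 := by
    have : locq.range = ⊥ := by
      rw [eq_bot_iff]
      rintro _ ⟨x, rfl⟩
      have hx : (x : Hm) ∈ (⊥ : AddSubgroup Hm) := hcore ▸ x.2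
      have : x = 0 := by ext; simpa using hx
      simp [this]
    rw [this, AddSubgroup.card_bot]
  rw [hrange_q, one_mul, hQ'card] at horth_q
  -- `locq'` is injective (its kernel is `A' = 0`)
  have hinj : Function.Injective locq' := by
    rw [injective_iff_map_eq_zero]
    intro x hx
    have hx' : (x : Hm) ∈ (⊥ : AddSubgroup Hm) := hcore ▸ (hker x).mp hx
    ext; simpa using hx'
  -- hence `C'` is cyclic of order `p^t`
  haveI : IsAddCyclic C' := isAddCyclic_of_injective locq' hinj
  have hcardC' : Nat.card C' = p ^ t := by
    rw [← horth_q]; exact Nat.card_congr (AddMonoidHom.ofInjective hinj).toEquiv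
  obtain ⟨g, hg⟩ := IsAddCyclic.exists_generator (α := C')
  have hordg : addOrderOf (g : Hm) = p ^ t := by
    rw [AddSubgroup.addOrderOf_coe, addOrderOf_eq_card_of_forall_mem_zmultiples hg, hcardC']
  have hg0 : (g : Hm) ≠ 0 := by
    intro h
    rw [h, addOrderOf_zero] at hordg
    have : 1 < p ^ t := Nat.one_lt_pow ht0.ne' hp.one_lt
    omega
  -- `C'` is generated by `g` inside `Hm`
  have hC'eq : C' = AddSubgroup.zmultiples (g : Hm) := by
    apply le_antisymm
    · intro x hx
      obtain ⟨k, hk⟩ := AddSubgroup.mem_zmultiples_iff.mp (hg ⟨x, hx⟩)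
      exact AddSubgroup.mem_zmultiples_iff.mpr ⟨k, by simpa using congrArg Subtype.val hk⟩
    · exact AddSubgroup.zmultiples_le_of_mem g.2
  -- Lemma 6.1: choose `ℓ` (applied to `κ` itself and the generator of `C'`)
  obtain ⟨ℓ, hℓP, hℓM⟩ := h61 (g : Hm) g.2 hg0
  rw [hordκ] at hℓP
  rw [hordg] at hℓM
  -- `#loc_λ(C') = p^t`, so `#D' ℓ = p^(m - t)`
  have hcard_img : Nat.card (C'.map (locM ℓ)) = p ^ t := by
    rw [hC'eq, AddMonoidHom.map_zmultiples, Nat.card_zmultiples, hℓM]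
  have hsing_inj : Function.Injective (sing ℓ) := by
    rw [injective_iff_map_eq_zero]
    intro x hx
    have hx' : (x : Hm) ∈ (⊥ : AddSubgroup Hm) := hB' ▸ (hsing ℓ x).mp hx
    ext; simpa using hx'
  have hcardD : Nat.card (D' ℓ) = p ^ (m - t) := by
    have h1 : Nat.card (D' ℓ) = Nat.card (sing ℓ).range :=
      Nat.card_congr (AddMonoidHom.ofInjective hsing_inj).toEquiv
    have h2 := horth_ℓ ℓ
    rw [hcard_img, ← h1, ← Nat.sub_add_cancel htm, pow_add] at h2
    exact Nat.eq_of_mul_eq_mul_right (pow_pos hp.pos t) h2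
  -- the order of `loc_λ κ_{cℓ,m}` divides `p^(m - t)` …
  have hdvd : addOrderOf (locM ℓ (κℓ ℓ)) ∣ p ^ (m - t) :=
    hcardD ▸ addOrderOf_map_dvd_card_of_mem (locM ℓ) (D' ℓ) (h49 ℓ)
  -- … and equals `ord loc_λ κ_{c,m} = ord κ_{c,m} = p^(m - mInf)`
  rw [h47 ℓ, hℓP, Nat.pow_dvd_pow_iff_le_right hp.one_lt] at hdvd
  omega

end Summit.BirchSwinnertonDyer.Rank1Residual.JET.Section6

end
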